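import Summits.AtomisticToContinuum.HydrodynamicLimit.Theses.LambertianContactSwap
import Summits.AtomisticToContinuum.HydrodynamicLimit.Theses.VanishingNoise
import Summits.AtomisticToContinuum.HydrodynamicLimit.Theorems.LambertianContactSwapSwapGapOfHydrodynamicLimit
import Summits.AtomisticToContinuum.HydrodynamicLimit.Theorems.LambertianContactSwapLocalGibbsProbability
import Literature.MathematicalPhysics.KineticTheory.HardSphereEulerProofs
import HarnessLib

/-!
# `SwapGap` (stmt-AtomisticToContinuum-11850) from the dice cruxes of route `VanishingNoise`: the dice transfer (glue)

Helper file (`--supports stmt-AtomisticToContinuum-11850`) recording, as kernel-checked CONDITIONAL glue, the composition of the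
alternative line `dice-transfer` (crux-strategist s2, `Cruxes/SwapGap/Lines/dice_transfer.lean`, census §D5/§T7):

* `hydrodynamicLimit_unguarded_of_dice` : `VanishingNoise.DiceContinuity → VanishingNoise.RareDiceEuler →
  Literature.MathematicalPhysics.KineticTheory.HydrodynamicLimit` (the UNGUARDED Literature conjunct) — the portmanteau along the
  dice schedule `q_N := (N+1)^{-1/6}`: per field and `δ > 0`, with the `1`-Lipschitz cut-off `min 1 (max 0 (dev − δ/2))`, Markov on
  the (measurable) deterministic side, `DiceContinuity` (stmt-AtomisticToContinuum-8723) to pass to the dice gas, a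
  measurability-free upper bound on the dice side, and `RareDiceEuler` (stmt-AtomisticToContinuum-8722) to conclude.  This is the
  tactic body of `VanishingNoise.closes` as certified 2026-08-16T06:08Z, whose conclusion was this statement before the D-0032
  re-type of the summit conjunct (the proof is the strategist's, landed verbatim by the continuation lead c7 of line `Sketch`,
  who alone may write under `Theorems/`).
* `swapGap_of_dice` : `DiceContinuity → RareDiceEuler → LambertianContactSwap.LambertianEuler → LambertianContactSwap.SwapGap`,
  by the landed `swapGap_of_hydrodynamicLimit` (p-§7 of line `Sketch`) with `localGibbsProbability_proof`.

So the crux follows from the EXISTING items stmt-8723 ∧ stmt-8722 ∧ stmt-11854 — a third conditional closing of `SwapGap` from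
other routes' items next to `swapGap_of_randomFutureTransfer` (stmt-11851 ∧ 11852 ∧ 11853, p126695) and
`swapGap_of_relEntropyVanishing_of_lambertianEuler` (stmt-0766 ∧ 11854, p126998).  Honest status (census): at summit level this
line is dominated by route `VanishingNoise` itself (8723 ∧ 8722 already decide the conjunct without `Λ`); its value here is
organisational — the deterministic-side obligation is a Russo influence BOUND (`CoinInfluence`, stmt-8724), the random-side
obligations are in-probability Euler limits (no speed-`N` large deviations).

References: S. Olla, S. R. S. Varadhan, H.-T. Yau, Comm. Math. Phys. 155 (1993) 523–560, Thm 2.1 / Cor. 2.2 (weak-noise regime);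
C. Kipnis, C. Landim, *Scaling Limits of Interacting Particle Systems* (1999), Ch. 6 §1 (portmanteau / entropy transfer pattern).
(buildfix 2026-08-20: comment-only re-land to re-enqueue the module build after its blocking imports were repaired; no declaration changed.)
-/

noncomputable section

namespace Summit.AtomisticToContinuum.HydrodynamicLimit.Theorems

open scoped BigOperators Topology Classical MeasureTheory ProbabilityTheory ENNReal
open Filter Set Function MeasureTheory
open Summit.AtomisticToContinuum.HydrodynamicLimit.Theses

/-- **Dice cruxes ⟹ the UNGUARDED hydrodynamic limit of the deterministic gas.**  `DiceContinuity` (stmt-8723) and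
`RareDiceEuler` (stmt-8722) imply `Literature.MathematicalPhysics.KineticTheory.HydrodynamicLimit`: portmanteau along
`q_N := (N+1)^{-1/6}` — per field and `δ > 0`, with the `1`-Lipschitz cut-off `min 1 (max 0 (dev − δ/2))`,
`min(1,δ/2)·P_N{δ < dev(Φ_t)} ≤ E_{P_N}[cut-off ∘ Φ_t]` (Markov; `P_N` is a probability law for `σ ≤ 1/2`, fields measurable),
`= E_{P_N ⊗ noise(q_N)}[cut-off ∘ dflow_t] + o(1)` (D1), `≤ (P_N ⊗ noise(q_N)){δ/2 < dev(dflow_t)} + o(1)` (measurability-free)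
`→ 0` (D2).  Verbatim the certified tactic body of `VanishingNoise.closes` (pre-D-0032 conclusion); proof by crux-strategist s2
(`Cruxes/SwapGap/Lines/dice_transfer.lean`). [cite: OllaVaradhanYau1993, Thm 2.1 / Cor. 2.2] -/
theorem hydrodynamicLimit_unguarded_of_dice (h₁ : VanishingNoise.DiceContinuity) (h₂ : VanishingNoise.RareDiceEuler) :
    Literature.MathematicalPhysics.KineticTheory.HydrodynamicLimit := by
  have key : ∀ {X Y : ℕ → Type} [∀ N, MeasurableSpace (X N)] [∀ N, MeasurableSpace (Y N)]
      (P : ∀ N, Measure (X N)) (μ : ∀ N, Measure (Y N))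
      (gX : ∀ N, X N → ℝ × EuclideanSpace ℝ (Fin 3) × ℝ) (gY : ∀ N, Y N → ℝ × EuclideanSpace ℝ (Fin 3) × ℝ),
      (∀ F : ℝ × EuclideanSpace ℝ (Fin 3) × ℝ → ℝ, LipschitzWith 1 F → (∀ y, |F y| ≤ 1) →
        Tendsto (fun N => (∫ x, F (gX N x) ∂P N) - ∫ y, F (gY N y) ∂μ N) atTop (𝓝 0)) →
      ∀ (dev : ℝ × EuclideanSpace ℝ (Fin 3) × ℝ → ℝ) {δ : ℝ}, 0 < δ → (∀ a b, |dev a - dev b| ≤ dist a b) →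
      (∀ N, IsFiniteMeasure (P N)) → (∀ N, IsFiniteMeasure (μ N)) → (∀ N, Measurable fun x => dev (gX N x)) →
      Tendsto (fun N => μ N {y | δ / 2 < dev (gY N y)}) atTop (𝓝 0) →
      Tendsto (fun N => P N {x | δ < dev (gX N x)}) atTop (𝓝 0) := by
    intro X Y _ _ P μ gX gY hH dev δ hδ hdev hP hμ hmeas hB
    have hm0 : 0 < min 1 (δ / 2) := lt_min one_pos (half_pos hδ)
    have hG0 : ∀ r : ℝ, 0 ≤ min 1 (max 0 (r - δ / 2)) := fun r => le_min zero_le_one (le_max_left _ _)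
    have hG1 : ∀ r : ℝ, min 1 (max 0 (r - δ / 2)) ≤ 1 := fun r => min_le_left _ _
    have hGm : ∀ r : ℝ, δ < r → min 1 (δ / 2) ≤ min 1 (max 0 (r - δ / 2)) := fun r hr =>
      min_le_min le_rfl ((by linarith : δ / 2 ≤ r - δ / 2).trans (le_max_right _ _))
    have hGz : ∀ r : ℝ, r ≤ δ / 2 → min 1 (max 0 (r - δ / 2)) = 0 := fun r hr => by
      rw [max_eq_left (by linarith), min_eq_right (zero_le_one' ℝ)]
    have hA := hH (fun y => min 1 (max 0 (dev y - δ / 2))) (LipschitzWith.of_dist_le_mul fun a b => by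
        rw [NNReal.coe_one, one_mul, Real.dist_eq]
        calc |min 1 (max 0 (dev a - δ / 2)) - min 1 (max 0 (dev b - δ / 2))|
            ≤ |max 0 (dev a - δ / 2) - max 0 (dev b - δ / 2)| :=
              (abs_min_sub_min_le_max _ _ _ _).trans (by rw [sub_self, abs_zero, max_eq_right (abs_nonneg _)])
          _ ≤ |(dev a - δ / 2) - (dev b - δ / 2)| :=
              (abs_max_sub_max_le_max _ _ _ _).trans (by rw [sub_self, abs_zero, max_eq_right (abs_nonneg _)])
          _ = |dev a - dev b| := by rw [sub_sub_sub_cancel_right]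
          _ ≤ dist a b := hdev a b)
      (fun y => by rw [abs_of_nonneg (hG0 _)]; exact hG1 _)
    have hlow : ∀ N, min 1 (δ / 2) * (P N {x | δ < dev (gX N x)}).toReal ≤
        ∫ x, min 1 (max 0 (dev (gX N x) - δ / 2)) ∂P N := by
      intro N
      haveI := hP N
      have hE : MeasurableSet {x | δ < dev (gX N x)} := measurableSet_lt measurable_const (hmeas N)
      have hint : Integrable (fun x => min 1 (max 0 (dev (gX N x) - δ / 2))) (P N) := by
        refine Integrable.mono' (integrable_const (1 : ℝ)) ?_ (Eventually.of_forall fun x => ?_)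
        · exact ((continuous_const.min (continuous_const.max (continuous_id.sub continuous_const))).measurable.comp
            (hmeas N)).aestronglyMeasurable
        · rw [Real.norm_eq_abs, abs_of_nonneg (hG0 _)]; exact hG1 _
      have hind : ∫ x, {x | δ < dev (gX N x)}.indicator (fun _ => min 1 (δ / 2)) x ∂P N =
          min 1 (δ / 2) * (P N {x | δ < dev (gX N x)}).toReal := by
        rw [integral_indicator_const _ hE, smul_eq_mul, measureReal_def, mul_comm]
      rw [← hind]
      refine integral_mono ((integrable_const _).indicator hE) hint fun x => ?_
      by_cases hx : x ∈ {x | δ < dev (gX N x)}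
      · rw [Set.indicator_of_mem hx]; exact hGm _ hx
      · rw [Set.indicator_of_notMem hx]; exact hG0 _
    have hup : ∀ N, ∫ y, min 1 (max 0 (dev (gY N y) - δ / 2)) ∂μ N ≤ (μ N {y | δ / 2 < dev (gY N y)}).toReal := by
      intro N
      haveI := hμ N
      by_cases hint : Integrable (fun y => min 1 (max 0 (dev (gY N y) - δ / 2))) (μ N)
      · rw [integral_eq_lintegral_of_nonneg_ae (Eventually.of_forall fun y => hG0 _) hint.aestronglyMeasurable]
        refine ENNReal.toReal_mono (measure_ne_top _ _) ?_
        calc ∫⁻ y, ENNReal.ofReal (min 1 (max 0 (dev (gY N y) - δ / 2))) ∂μ N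
            ≤ ∫⁻ y, {y | δ / 2 < dev (gY N y)}.indicator (fun _ => (1 : ENNReal)) y ∂μ N :=
              lintegral_mono fun y => ?_
          _ ≤ ∫⁻ y in {y | δ / 2 < dev (gY N y)}, (fun _ => (1 : ENNReal)) y ∂μ N := lintegral_indicator_le _ _
          _ = μ N {y | δ / 2 < dev (gY N y)} := setLIntegral_one _
        by_cases hy : y ∈ {y | δ / 2 < dev (gY N y)}
        · rw [Set.indicator_of_mem hy]; exact ENNReal.ofReal_le_one.2 (hG1 _)
        · rw [Set.indicator_of_notMem hy]
          simp only [Set.mem_setOf_eq, not_lt] at hy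
          rw [hGz _ hy, ENNReal.ofReal_zero]
      · rw [integral_undef hint]; exact ENNReal.toReal_nonneg
    have hBr : Tendsto (fun N => (μ N {y | δ / 2 < dev (gY N y)}).toReal) atTop (𝓝 0) := by
      simpa [Function.comp_def] using (ENNReal.tendsto_toReal ENNReal.zero_ne_top).comp hB
    have hreal : Tendsto (fun N => (P N {x | δ < dev (gX N x)}).toReal) atTop (𝓝 0) := by
      refine squeeze_zero (fun N => ENNReal.toReal_nonneg) (fun N => ?_)
        (by simpa using (hA.abs.add hBr).div_const (min 1 (δ / 2)))
      rw [le_div_iff₀ hm0, mul_comm]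
      calc min 1 (δ / 2) * (P N {x | δ < dev (gX N x)}).toReal
          ≤ ∫ x, min 1 (max 0 (dev (gX N x) - δ / 2)) ∂P N := hlow N
        _ = ((∫ x, min 1 (max 0 (dev (gX N x) - δ / 2)) ∂P N) - ∫ y, min 1 (max 0 (dev (gY N y) - δ / 2)) ∂μ N) +
              ∫ y, min 1 (max 0 (dev (gY N y) - δ / 2)) ∂μ N := by ring
        _ ≤ _ := add_le_add (le_abs_self _) (hup N)
    have hne : ∀ N, P N {x | δ < dev (gX N x)} ≠ ⊤ := fun N => by haveI := hP N; exact measure_ne_top _ _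
    exact (ENNReal.tendsto_toReal_iff hne ENNReal.zero_ne_top).1 (by simpa using hreal)
  have hdD : ∀ (c : ℝ) (a b : ℝ × EuclideanSpace ℝ (Fin 3) × ℝ), |(|a.1 - c|) - (|b.1 - c|)| ≤ dist a b :=
    fun c a b => calc |(|a.1 - c|) - (|b.1 - c|)| ≤ |(a.1 - c) - (b.1 - c)| := abs_abs_sub_abs_le_abs_sub _ _
      _ = dist a.1 b.1 := by rw [sub_sub_sub_cancel_right, Real.dist_eq]
      _ ≤ dist a b := (le_max_left _ _).trans_eq Prod.dist_eq.symm
  have hdM : ∀ (c : EuclideanSpace ℝ (Fin 3)) (a b : ℝ × EuclideanSpace ℝ (Fin 3) × ℝ),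
      |‖a.2.1 - c‖ - ‖b.2.1 - c‖| ≤ dist a b :=
    fun c a b => calc |‖a.2.1 - c‖ - ‖b.2.1 - c‖| ≤ ‖(a.2.1 - c) - (b.2.1 - c)‖ := abs_norm_sub_norm_le _ _
      _ = dist a.2.1 b.2.1 := by rw [sub_sub_sub_cancel_right, dist_eq_norm]
      _ ≤ dist a.2 b.2 := (le_max_left _ _).trans_eq Prod.dist_eq.symm
      _ ≤ dist a b := (le_max_right _ _).trans_eq Prod.dist_eq.symm
  have hdE : ∀ (c : ℝ) (a b : ℝ × EuclideanSpace ℝ (Fin 3) × ℝ), |(|a.2.2 - c|) - (|b.2.2 - c|)| ≤ dist a b :=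
    fun c a b => calc |(|a.2.2 - c|) - (|b.2.2 - c|)| ≤ |(a.2.2 - c) - (b.2.2 - c)| := abs_abs_sub_abs_le_abs_sub _ _
      _ = dist a.2.2 b.2.2 := by rw [sub_sub_sub_cancel_right, Real.dist_eq]
      _ ≤ dist a.2 b.2 := (le_max_right _ _).trans_eq Prod.dist_eq.symm
      _ ≤ dist a b := (le_max_right _ _).trans_eq Prod.dist_eq.symm
  have hpos : ∀ (n : ℕ) (i : Fin n), Measurable fun z : Literature.Analysis.FluidPDE.Config n (Fin 3) (UnitAddTorus (Fin 3)) => (z i).1 :=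
    fun n i => (measurable_pi_apply i).fst
  have hvel : ∀ (n : ℕ) (i : Fin n), Measurable fun z : Literature.Analysis.FluidPDE.Config n (Fin 3) (UnitAddTorus (Fin 3)) => (z i).2 :=
    fun n i => (measurable_pi_apply i).snd
  have hmD : ∀ (n : ℕ) (χ : UnitAddTorus (Fin 3) → ℝ), Continuous χ →
      Measurable fun z : Literature.Analysis.FluidPDE.Config n (Fin 3) (UnitAddTorus (Fin 3)) => Literature.MathematicalPhysics.KineticTheory.empiricalDensityField z χ := by
    intro n χ hχ
    simp_rw [Literature.MathematicalPhysics.KineticTheory.empiricalDensityField_eq_sum]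
    exact measurable_const.mul (Finset.measurable_sum _ fun i _ => hχ.measurable.comp (hpos n i))
  have hmM : ∀ (n : ℕ) (χ : UnitAddTorus (Fin 3) → ℝ), Continuous χ →
      Measurable fun z : Literature.Analysis.FluidPDE.Config n (Fin 3) (UnitAddTorus (Fin 3)) => Literature.MathematicalPhysics.KineticTheory.empiricalMomentumField z χ := by
    intro n χ hχ
    simp_rw [Literature.MathematicalPhysics.KineticTheory.empiricalMomentumField_eq_sum]
    exact (Finset.measurable_sum _ fun i _ => (hχ.measurable.comp (hpos n i)).smul (hvel n i)).const_smul ((n : ℝ)⁻¹)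
  have hmE : ∀ (n : ℕ) (χ : UnitAddTorus (Fin 3) → ℝ), Continuous χ →
      Measurable fun z : Literature.Analysis.FluidPDE.Config n (Fin 3) (UnitAddTorus (Fin 3)) => Literature.MathematicalPhysics.KineticTheory.empiricalEnergyField z χ := by
    intro n χ hχ
    simp_rw [Literature.MathematicalPhysics.KineticTheory.empiricalEnergyField_eq_sum]
    exact measurable_const.mul (Finset.measurable_sum _ fun i _ =>
      (hχ.measurable.comp (hpos n i)).mul (((hvel n i).norm.pow_const 2).div_const 2))
  have hq_mem : ∀ N : ℕ, ((N : ℝ) + 1) ^ (-(1 / 6 : ℝ)) ∈ unitInterval := fun N =>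
    ⟨Real.rpow_nonneg (by positivity) _,
      Real.rpow_le_one_of_one_le_of_nonpos (by have := Nat.cast_nonneg (α := ℝ) N; linarith) (by norm_num)⟩
  let q : ℕ → unitInterval := fun N => ⟨((N : ℝ) + 1) ^ (-(1 / 6 : ℝ)), hq_mem N⟩
  have hN1 : Tendsto (fun N : ℕ => (N : ℝ) + 1) atTop atTop := tendsto_natCast_atTop_atTop.atTop_add tendsto_const_nhds
  have hq0 : Tendsto (fun N => (q N : ℝ)) atTop (𝓝 0) := (tendsto_rpow_neg_atTop (by norm_num : (0 : ℝ) < 1 / 6)).comp hN1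
  have hq1 : Tendsto (fun N : ℕ => (q N : ℝ) * ((N : ℝ) + 1) ^ (1 / 3 : ℝ)) atTop atTop := by
    refine ((tendsto_rpow_atTop (by norm_num : (0 : ℝ) < 1 / 6)).comp hN1).congr fun N => ?_
    show ((N : ℝ) + 1) ^ (1 / 6 : ℝ) = ((N : ℝ) + 1) ^ (-(1 / 6 : ℝ)) * ((N : ℝ) + 1) ^ (1 / 3 : ℝ)
    rw [← Real.rpow_add (by positivity : (0 : ℝ) < (N : ℝ) + 1)]
    norm_num
  intro a₀ θ₀ u₀ ha hθ hu ha0 hθ0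
  obtain ⟨σ₁, hσ₁, H₁⟩ := h₁ a₀ θ₀ u₀ ha hθ hu ha0 hθ0
  obtain ⟨σ₂, hσ₂, H₂⟩ := h₂ q hq0 hq1 a₀ θ₀ u₀ ha hθ hu ha0 hθ0
  refine ⟨min (min σ₁ σ₂) (1 / 2), by positivity, ?_⟩
  intro σ hσ hσlt T ρ θ u hsol Φ h0 t ht
  have hσ₁' : σ < σ₁ := lt_of_lt_of_le hσlt ((min_le_left _ _).trans (min_le_left _ _))
  have hσ₂' : σ < σ₂ := lt_of_lt_of_le hσlt ((min_le_left _ _).trans (min_le_right _ _))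
  have hPfin : ∀ N, IsFiniteMeasure (Literature.MathematicalPhysics.KineticTheory.localGibbsLaw σ a₀ u₀ θ₀ N (Φ N)) := fun N => by
    haveI := Literature.MathematicalPhysics.KineticTheory.isProbabilityMeasure_localGibbsLaw ha hθ hu ha0 hθ0 (lt_of_lt_of_le hσlt (min_le_right _ _)).le N (Φ N)
    infer_instance
  specialize H₁ σ hσ hσ₁' T ρ θ u hsol Φ h0 t ht
  specialize H₂ σ hσ hσ₂' T ρ θ u hsol Φ h0 t ht
  intro χ hχ δ hδ
  refine ⟨?_, ?_, ?_⟩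
  · have hres := key _ _ _ _ (fun F hF hF1 => H₁ χ hχ F hF hF1 q hq0) (fun y => |y.1 - ∫ x, χ x * ρ t x|) hδ (hdD _)
      hPfin (fun N => by dsimp only; infer_instance)
      (fun N => by exact continuous_abs.measurable.comp (((hmD (N + 1) χ hχ).comp ((Φ N).measurable_flow t)).sub measurable_const))
      (H₂ χ hχ (δ / 2) (half_pos hδ)).1
    exact hres
  · have hres := key _ _ _ _ (fun F hF hF1 => H₁ χ hχ F hF hF1 q hq0) (fun y => ‖y.2.1 - ∫ x, (χ x * ρ t x) • u t x‖) hδ (hdM _)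
      hPfin (fun N => by dsimp only; infer_instance)
      (fun N => by exact (((hmM (N + 1) χ hχ).comp ((Φ N).measurable_flow t)).sub measurable_const).norm)
      (H₂ χ hχ (δ / 2) (half_pos hδ)).2.1
    exact hres
  · have hres := key _ _ _ _ (fun F hF hF1 => H₁ χ hχ F hF hF1 q hq0)
      (fun y => |y.2.2 - ∫ x, χ x * Literature.MathematicalPhysics.KineticTheory.totalEnergyDensity (ρ t x) (u t x) (θ t x)|) hδ (hdE _)
      hPfin (fun N => by dsimp only; infer_instance)
      (fun N => by exact continuous_abs.measurable.comp (((hmE (N + 1) χ hχ).comp ((Φ N).measurable_flow t)).sub measurable_const))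
      (H₂ χ hχ (δ / 2) (half_pos hδ)).2.2
    exact hres

/-- **The dice transfer for the crux**: `DiceContinuity → RareDiceEuler → LambertianEuler → SwapGap` — the unguarded conjunct
from the two dice cruxes (`hydrodynamicLimit_unguarded_of_dice`), then the landed `swapGap_of_hydrodynamicLimit` with
`localGibbsProbability_proof` and `LambertianEuler` (stmt-11854).  Composition of line `dice-transfer` (crux-strategist s2).
[cite: OllaVaradhanYau1993, Thm 2.1 / Cor. 2.2] -/
theorem swapGap_of_dice :
    Summit.AtomisticToContinuum.HydrodynamicLimit.Theses.VanishingNoise.DiceContinuity →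
      Summit.AtomisticToContinuum.HydrodynamicLimit.Theses.VanishingNoise.RareDiceEuler →
        Summit.AtomisticToContinuum.HydrodynamicLimit.Theses.LambertianContactSwap.LambertianEuler →
          Summit.AtomisticToContinuum.HydrodynamicLimit.Theses.LambertianContactSwap.SwapGap :=
  fun hD hR hL => swapGap_of_hydrodynamicLimit localGibbsProbability_proof hL (hydrodynamicLimit_unguarded_of_dice hD hR)

end Summit.AtomisticToContinuum.HydrodynamicLimit.Theorems
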